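import Literature.Geometry.Lorentzian.CoordTensorEvolution
import HarnessLib

/-!
# Iterated covariant derivatives of the curvature and the `Rm * Rm` calculus (`∇^k Rm`)

Fifth layer of the rank-generic coordinate tensor calculus, towards Shi's global derivative
estimates for all orders (Topping 2006, Thm. 3.3.1) and the curvature blow-up theorem
(Thm. 5.3.1). Along a smooth family of metric components `G` on `V × S`:

* `curvD G b k t = ∇^k Rm` — the `k`-th covariant derivative of the lowered curvature tensor of
  `G t`, a component field of index type `Fin (4 + k)` (`curvD 0 = rm4`,
  `curvD (k+1) = (∇ curvD k) ∘ idxEquiv`); it is the general iterate `tcovIter` of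
  `CoordRicciCovariantIter.lean` applied to `rm4`, up to the relabelling `curvIdxEquiv k :
  Fin k ⊕ Fin 4 ≃ Fin (4 + k)` (**`curvD_eq_tcovIter`**, so that the coordinate-derivative layer
  `fderiv_tcovIter_apply` of that file applies to `∇^k Rm`);
* `curvL G S b k t = ∂_t ∇^kRm − Δ ∇^kRm` — the lower-order part of the evolution equation of
  `∇^k Rm` (Topping, (3.3.3): `∂_t ∇^kRm = Δ∇^kRm + Σ_j ∇^jRm * ∇^{k−j}Rm`);
* **`StarQuad` — Hamilton's `*`-notation made precise**: the inductively generated class of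
  time-dependent fields obtained from the products `∇^pRm ⊗ ∇^qRm` (`p + q = n`, level `n`) by
  relabelling of slots, metric traces, sums and scalar multiples (and agreement on `V × S`);
* `StarQuad.tsmoothFamOn`, **`StarQuad.deriv` (closure under `∇`, level `n ↦ n + 1`: the Leibniz
  rule and `∇ g⁻¹ = 0`)** and **`StarQuad.norm_le` (every field of level `n` is bounded pointwise by
  `C Σ_p |∇^pRm| |∇^{n−p}Rm|` at positive definite points)** — the two properties of `*`-products
  used in the proof of Thm. 3.3.1.

Everything is proved; no definition of `Prop` type besides the inductive predicate `StarQuad`.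

## References

* P. Topping, *Lectures on the Ricci flow*, LMS Lecture Note Series 325, CUP 2006, §2.2
  (`*`-notation), §3.3 (proof of Thm. 3.3.1, (3.3.3)). [Topping2006]
* R. S. Hamilton, *Three-manifolds with positive Ricci curvature*, J. Differential Geom. 17
  (1982), §13 (the `*`-calculus and the derivative estimates). [Hamilton1982]
-/

noncomputable section

set_option maxSynthPendingDepth 3

open Set Filter ContinuousLinearMap Module Function
open scoped Topology ContDiff

namespace Literature.Geometry.Lorentzian

namespace MetricCoord

/-! ### Relabelling equivalences and algebraic identities of fields -/

section Equivs

variable {E ι : Type*} {α β : Type*}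

/-- `Option α ⊕ β ≃ Option (α ⊕ β)` (the derivative slot of the left factor to the front). [folklore] -/
def sumOptionLeft (α β : Type*) : Option α ⊕ β ≃ Option (α ⊕ β) where
  toFun
    | Sum.inl none => none
    | Sum.inl (some a) => some (Sum.inl a)
    | Sum.inr c => some (Sum.inr c)
  invFun
    | none => Sum.inl none
    | some (Sum.inl a) => Sum.inl (some a)
    | some (Sum.inr c) => Sum.inr c
  left_inv := by rintro ((_ | a) | c) <;> rfl
  right_inv := by rintro (_ | a | c) <;> rfl

/-- `α ⊕ Option β ≃ Option (α ⊕ β)` (the derivative slot of the right factor to the front). [folklore] -/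
def sumOptionRight (α β : Type*) : α ⊕ Option β ≃ Option (α ⊕ β) where
  toFun
    | Sum.inl a => some (Sum.inl a)
    | Sum.inr none => none
    | Sum.inr (some c) => some (Sum.inr c)
  invFun
    | none => Sum.inr none
    | some (Sum.inl a) => Sum.inl a
    | some (Sum.inr c) => Sum.inr (some c)
  left_inv := by rintro (a | (_ | c)) <;> rfl
  right_inv := by rintro (_ | a | c) <;> rfl

/-- `α ⊕ Option (Option β) ≃ Option (Option (α ⊕ β))` (the traced slots of the right factor to the
front). [folklore] -/
def sumOption₂Right (α β : Type*) : α ⊕ Option (Option β) ≃ Option (Option (α ⊕ β)) where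
  toFun
    | Sum.inl a => some (some (Sum.inl a))
    | Sum.inr none => none
    | Sum.inr (some none) => some none
    | Sum.inr (some (some c)) => some (some (Sum.inr c))
  invFun
    | none => Sum.inr none
    | some none => Sum.inr (some none)
    | some (some (Sum.inl a)) => Sum.inl a
    | some (some (Sum.inr c)) => Sum.inr (some (some c))
  left_inv := by rintro (a | (_ | _ | c)) <;> rfl
  right_inv := by rintro (_ | _ | a | c) <;> rfl

/-- `Option (Option α) ⊕ β ≃ Option (Option (α ⊕ β))` (the traced slots of the left factor to the
front). [folklore] -/
def sumOption₂Left (α β : Type*) : Option (Option α) ⊕ β ≃ Option (Option (α ⊕ β)) where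
  toFun
    | Sum.inl none => none
    | Sum.inl (some none) => some none
    | Sum.inl (some (some a)) => some (some (Sum.inl a))
    | Sum.inr c => some (some (Sum.inr c))
  invFun
    | none => Sum.inl none
    | some none => Sum.inl (some none)
    | some (some (Sum.inl a)) => Sum.inl (some (some a))
    | some (some (Sum.inr c)) => Sum.inr c
  left_inv := by rintro ((_ | _ | a) | c) <;> rfl
  right_inv := by rintro (_ | _ | a | c) <;> rfl

/-- The 3-cycle of the three outermost slots bringing the derivative slot behind the two traced
slots: `(p, q, j, I) ∘ cycTop = (j, p, q, I)`. [folklore] -/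
def cycTop (γ : Type*) : Option (Option (Option γ)) ≃ Option (Option (Option γ)) where
  toFun
    | none => some (some none)
    | some none => none
    | some (some none) => some none
    | some (some (some a)) => some (some (some a))
  invFun
    | none => some none
    | some none => some (some none)
    | some (some none) => none
    | some (some (some a)) => some (some (some a))
  left_inv := by rintro (_ | _ | _ | a) <;> rfl
  right_inv := by rintro (_ | _ | _ | a) <;> rfl

/-- `(p, q, j, I) ∘ cycTop = (j, p, q, I)`. [folklore] -/
theorem ocons₃_comp_cycTop (p q j : ι) (I : α → ι) :
    ocons p (ocons q (ocons j I)) ∘ cycTop α = ocons j (ocons p (ocons q I)) := by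
  funext o; rcases o with _ | _ | _ | a <;> rfl

variable {γ : Type*}

/-- `(S ∘ e) ⊗ T = (S ⊗ T) ∘ (e ⊕ id)`. [folklore] -/
theorem tprod_treindex_left (e : α ≃ γ) (S : E → (α → ι) → ℝ) (T : E → (β → ι) → ℝ) :
    tprod (treindex e S) T = treindex (e.sumCongr (Equiv.refl β)) (tprod S T) := by
  funext x K; rfl

/-- `S ⊗ (T ∘ e) = (S ⊗ T) ∘ (id ⊕ e)`. [folklore] -/
theorem tprod_treindex_right (e : β ≃ γ) (S : E → (α → ι) → ℝ) (T : E → (β → ι) → ℝ) :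
    tprod S (treindex e T) = treindex ((Equiv.refl α).sumCongr e) (tprod S T) := by
  funext x K; rfl

/-- `⊗` is additive on the left. [folklore] -/
theorem tprod_add_left (S S' : E → (α → ι) → ℝ) (T : E → (β → ι) → ℝ) :
    tprod (S + S') T = tprod S T + tprod S' T := by
  funext x K; simp only [tprod_apply, Pi.add_apply]; ring

/-- `⊗` is additive on the right. [folklore] -/
theorem tprod_add_right (S : E → (α → ι) → ℝ) (T T' : E → (β → ι) → ℝ) :
    tprod S (T + T') = tprod S T + tprod S T' := by
  funext x K; simp only [tprod_apply, Pi.add_apply]; ring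

/-- `⊗` commutes with subtraction on the left. [folklore] -/
theorem tprod_sub_left (S S' : E → (α → ι) → ℝ) (T : E → (β → ι) → ℝ) :
    tprod (S - S') T = tprod S T - tprod S' T := by
  funext x K; simp only [tprod_apply, Pi.sub_apply]; ring

/-- `⊗` commutes with subtraction on the right. [folklore] -/
theorem tprod_sub_right (S : E → (α → ι) → ℝ) (T T' : E → (β → ι) → ℝ) :
    tprod S (T - T') = tprod S T - tprod S T' := by
  funext x K; simp only [tprod_apply, Pi.sub_apply]; ring

/-- `⊗` is homogeneous on the left. [folklore] -/
theorem tprod_smul_left (c : ℝ) (S : E → (α → ι) → ℝ) (T : E → (β → ι) → ℝ) :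
    tprod (c • S) T = c • tprod S T := by
  funext x K; simp only [tprod_apply, Pi.smul_apply, smul_eq_mul]; ring

/-- `⊗` is homogeneous on the right. [folklore] -/
theorem tprod_smul_right (c : ℝ) (S : E → (α → ι) → ℝ) (T : E → (β → ι) → ℝ) :
    tprod S (c • T) = c • tprod S T := by
  funext x K; simp only [tprod_apply, Pi.smul_apply, smul_eq_mul]; ring

/-- `⊗` commutes with negation on the left. [folklore] -/
theorem tprod_neg_left (S : E → (α → ι) → ℝ) (T : E → (β → ι) → ℝ) : tprod (-S) T = -tprod S T := by
  funext x K; simp only [tprod_apply, Pi.neg_apply]; ring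

/-- `⊗` commutes with negation on the right. [folklore] -/
theorem tprod_neg_right (S : E → (α → ι) → ℝ) (T : E → (β → ι) → ℝ) : tprod S (-T) = -tprod S T := by
  funext x K; simp only [tprod_apply, Pi.neg_apply]; ring

/-- `⊗` commutes with finite sums on the left. [folklore] -/
theorem tprod_sum_left {κ : Type*} (s : Finset κ) (F : κ → E → (α → ι) → ℝ) (T : E → (β → ι) → ℝ) :
    tprod (∑ c ∈ s, F c) T = ∑ c ∈ s, tprod (F c) T := by
  funext x K
  simp only [tprod_apply, Finset.sum_apply, Finset.sum_mul]

/-- `⊗` commutes with finite sums on the right. [folklore] -/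
theorem tprod_sum_right {κ : Type*} (s : Finset κ) (S : E → (α → ι) → ℝ) (F : κ → E → (β → ι) → ℝ) :
    tprod S (∑ c ∈ s, F c) = ∑ c ∈ s, tprod S (F c) := by
  funext x K
  simp only [tprod_apply, Finset.sum_apply, Finset.mul_sum]

/-- Relabelling commutes with finite sums. [folklore] -/
theorem treindex_sum {κ : Type*} (s : Finset κ) (e : α ≃ β) (F : κ → E → (α → ι) → ℝ) :
    treindex e (∑ c ∈ s, F c) = ∑ c ∈ s, treindex e (F c) := by
  funext x K
  simp only [treindex_apply, Finset.sum_apply]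

end Equivs

variable {E : Type*} [NormedAddCommGroup E] [NormedSpace ℝ E] {ι : Type*}

section MetricEquivs

variable [Fintype ι] {G : E → E →L[ℝ] E →L[ℝ] ℝ} {b : Basis ι ℝ E} {α β : Type*} [FiniteDimensional ℝ E]

/-- **`S ⊗ tr T = tr ((S ⊗ T) ∘ e)`**: the trace of one factor is a trace of the product. [folklore] -/
theorem tprod_ttr (S : E → (α → ι) → ℝ) (T : E → (Option (Option β) → ι) → ℝ) :
    tprod S (ttr G b T) = ttr G b (treindex (sumOption₂Right α β) (tprod S T)) := by
  funext x K
  rw [tprod_apply, ttr_apply, ttr_apply, Finset.mul_sum]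
  refine Finset.sum_congr rfl fun j _ ↦ ?_
  rw [Finset.mul_sum]
  refine Finset.sum_congr rfl fun k _ ↦ ?_
  rw [treindex_apply, tprod_apply]
  have h1 : (ocons j (ocons k K) ∘ sumOption₂Right α β) ∘ Sum.inl = K ∘ Sum.inl := by
    funext a; rfl
  have h2 : (ocons j (ocons k K) ∘ sumOption₂Right α β) ∘ Sum.inr = ocons j (ocons k (K ∘ Sum.inr)) := by
    funext o; rcases o with _ | _ | c <;> rfl
  rw [h1, h2]
  ring

/-- **`tr S ⊗ T = tr ((S ⊗ T) ∘ e)`.** [folklore] -/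
theorem ttr_tprod (S : E → (Option (Option α) → ι) → ℝ) (T : E → (β → ι) → ℝ) :
    tprod (ttr G b S) T = ttr G b (treindex (sumOption₂Left α β) (tprod S T)) := by
  funext x K
  rw [tprod_apply, ttr_apply, ttr_apply, Finset.sum_mul]
  refine Finset.sum_congr rfl fun j _ ↦ ?_
  rw [Finset.sum_mul]
  refine Finset.sum_congr rfl fun k _ ↦ ?_
  rw [treindex_apply, tprod_apply]
  have h1 : (ocons j (ocons k K) ∘ sumOption₂Left α β) ∘ Sum.inl = ocons j (ocons k (K ∘ Sum.inl)) := by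
    funext o; rcases o with _ | _ | a <;> rfl
  have h2 : (ocons j (ocons k K) ∘ sumOption₂Left α β) ∘ Sum.inr = K ∘ Sum.inr := by
    funext c; rfl
  rw [h1, h2]
  ring

/-- **Trace of finite sums.** [folklore] -/
theorem ttr_sum {κ : Type*} (s : Finset κ) (F : κ → E → (Option (Option α) → ι) → ℝ) (x : E) (I : α → ι) :
    ttr (α := α) G b (∑ c ∈ s, F c) x I = ∑ c ∈ s, ttr G b (F c) x I := by
  simp only [ttr_apply, Finset.sum_apply, Finset.mul_sum]
  exact (Finset.sum_congr rfl fun j _ ↦ Finset.sum_comm).trans Finset.sum_comm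

variable [Fintype α] [DecidableEq α] [Fintype β] [DecidableEq β] {V : Set E} {x : E}

omit [FiniteDimensional ℝ E] in
/-- **The Leibniz rule as an identity of fields**: on `V`,
`∇(S ⊗ T) = (∇S ⊗ T) ∘ e_L + (S ⊗ ∇T) ∘ e_R`. [cite: ONeill1983, Ch. 2, Prop. 2.13] -/
theorem tcov_tprod_eq (hV : IsOpen V) {S : E → (α → ι) → ℝ} {T : E → (β → ι) → ℝ} (hS : TSmoothOn S V)
    (hT : TSmoothOn T V) (hx : x ∈ V) (K : Option (α ⊕ β) → ι) :
    tcov G b (tprod S T) x K =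
      (treindex (sumOptionLeft α β) (tprod (tcov G b S) T)
        + treindex (sumOptionRight α β) (tprod S (tcov G b T))) x K := by
  rw [tcov_tprod hV hS hT hx, Pi.add_apply, Pi.add_apply, treindex_apply, treindex_apply, tprod_apply,
    tprod_apply]
  have h1 : (K ∘ sumOptionLeft α β) ∘ Sum.inl = ocons (K none) (K ∘ some ∘ Sum.inl) := by
    funext o; rcases o with _ | a <;> rfl
  have h2 : (K ∘ sumOptionLeft α β) ∘ Sum.inr = K ∘ some ∘ Sum.inr := by funext c; rfl
  have h3 : (K ∘ sumOptionRight α β) ∘ Sum.inl = K ∘ some ∘ Sum.inl := by funext a; rfl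
  have h4 : (K ∘ sumOptionRight α β) ∘ Sum.inr = ocons (K none) (K ∘ some ∘ Sum.inr) := by
    funext o; rcases o with _ | c <;> rfl
  rw [h1, h2, h3, h4]

variable [CompleteSpace E]

/-- **`∇ tr T = tr ((∇T) ∘ cycTop)` as an identity of fields on `V`.** [cite: ONeill1983, Ch. 3, Prop. 3.13] -/
theorem IsMetricOn.tcov_ttr_eq (hG : IsMetricOn G V) {T : E → (Option (Option α) → ι) → ℝ}
    (hT : TSmoothOn T V) (hx : x ∈ V) (J : Option α → ι) :
    tcov G b (ttr G b T) x J = ttr G b (treindex (cycTop α) (tcov G b T)) x J := by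
  rw [← ocons_eta J, hG.tcov_ttr hT hx, ttr_apply]
  refine Finset.sum_congr rfl fun p _ ↦ Finset.sum_congr rfl fun q _ ↦ ?_
  rw [treindex_apply, ocons₃_comp_cycTop]

end MetricEquivs

/-! ### `∇^k Rm` and the lower-order part of its evolution -/

section CurvD

variable [Fintype ι] (G : ℝ → E → E →L[ℝ] E →L[ℝ] ℝ) (S : Set ℝ) (b : Basis ι ℝ E) [FiniteDimensional ℝ E]

/-- The relabelling `Option (Fin (4 + k)) ≃ Fin (4 + (k + 1))` placing the new derivative slot
first (`finSuccEquiv`). [folklore] -/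
def idxEquiv (k : ℕ) : Option (Fin (4 + k)) ≃ Fin (4 + (k + 1)) :=
  (finSuccEquiv (4 + k)).symm

/-- **`∇^k Rm`**: the `k`-th covariant derivative of the lowered curvature tensor of `G t`, as a
component field of index type `Fin (4 + k)` (`∇^0 Rm = Rm`, `∇^{k+1}Rm = ∇(∇^kRm)` with the new
slot first). [cite: Topping2006, §3.3, Thm. 3.3.1] -/
def curvD : (k : ℕ) → ℝ → E → (Fin (4 + k) → ι) → ℝ
  | 0 => fun t ↦ rm4 (G t) b
  | k + 1 => fun t ↦ treindex (idxEquiv k) (tcov (G t) b (curvD k t))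

/-- **The lower-order part of the evolution of `∇^kRm`**: `curvL k t = ∂_t ∇^kRm − Δ ∇^kRm`
(Topping, (3.3.3): `∂_t ∇^kRm = Δ∇^kRm + Σ_j ∇^jRm * ∇^{k−j}Rm`). [cite: Topping2006, §3.3, (3.3.3)] -/
def curvL (k : ℕ) (t : ℝ) : E → (Fin (4 + k) → ι) → ℝ :=
  fun x I ↦ tder (curvD G b k) S t x I - tlap (G t) b (curvD G b k t) x I

variable {G S}

omit [FiniteDimensional ℝ E] in
/-- `curvD 0 = Rm`. [cite: Topping2006, §3.3] -/
theorem curvD_zero (t : ℝ) : curvD G b 0 t = rm4 (G t) b := rfl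

omit [FiniteDimensional ℝ E] in
/-- `curvD (k+1) = (∇ curvD k) ∘ idxEquiv`. [cite: Topping2006, §3.3] -/
theorem curvD_succ (k : ℕ) (t : ℝ) : curvD G b (k + 1) t = treindex (idxEquiv k) (tcov (G t) b (curvD G b k t)) := rfl

omit [FiniteDimensional ℝ E] in
/-- `∇ (∇^k Rm) = (∇^{k+1} Rm) ∘ idxEquiv⁻¹`. [cite: Topping2006, §3.3] -/
theorem tcov_curvD (k : ℕ) (t : ℝ) :
    tcov (G t) b (curvD G b k t) = treindex (idxEquiv k).symm (curvD G b (k + 1) t) := by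
  rw [curvD_succ, treindex_treindex, Equiv.self_trans_symm, treindex_refl]

omit [FiniteDimensional ℝ E] in
/-- The relabelling `Fin k ⊕ Fin 4 ≃ Fin (4 + k)` between the index convention of `tcovIter`
(`CoordRicciCovariantIter.lean`: derivative slots `inl`, newest first; the slots of `Rm` as `inr`)
and that of `curvD` (one block `Fin (4 + k)`: derivative slots first, newest first, the four slots
of `Rm` last): `inl i ↦ i`, `inr j ↦ k + j`. [folklore] -/
def curvIdxEquiv (k : ℕ) : Fin k ⊕ Fin 4 ≃ Fin (4 + k) :=
  finSumFinEquiv.trans (finCongr (Nat.add_comm k 4))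

omit [FiniteDimensional ℝ E] in
/-- `curvIdxEquiv k (inl i) = i` (as a natural number). [folklore] -/
@[simp] theorem val_curvIdxEquiv_inl (k : ℕ) (i : Fin k) : ((curvIdxEquiv k (Sum.inl i) : Fin (4 + k)) : ℕ) = i := by
  simp [curvIdxEquiv]

omit [FiniteDimensional ℝ E] in
/-- `curvIdxEquiv k (inr j) = k + j` (as a natural number). [folklore] -/
@[simp] theorem val_curvIdxEquiv_inr (k : ℕ) (j : Fin 4) : ((curvIdxEquiv k (Sum.inr j) : Fin (4 + k)) : ℕ) = k + j := by
  simp [curvIdxEquiv, Nat.add_comm]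

omit [FiniteDimensional ℝ E] in
/-- The two successor conventions agree: `optionCongr curvIdxEquiv ≫ idxEquiv = shiftEquiv ≫ curvIdxEquiv`.
[folklore] -/
theorem curvIdxEquiv_optionCongr_trans_idxEquiv (k : ℕ) :
    (curvIdxEquiv k).optionCongr.trans (idxEquiv k) = (shiftEquiv k (Fin 4)).trans (curvIdxEquiv (k + 1)) := by
  refine Equiv.ext fun o ↦ Fin.ext ?_
  rcases o with _ | i | j
  · simp [idxEquiv]
  · simp [idxEquiv]
  · simp only [Equiv.trans_apply, Equiv.optionCongr_apply, Option.map_some, idxEquiv,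
      finSuccEquiv_symm_some, Fin.val_succ, val_curvIdxEquiv_inr, shiftEquiv_some_inr]
    omega

omit [FiniteDimensional ℝ E] in
/-- **`curvD` is the general iterated covariant derivative `tcovIter` of `rm4`, relabelled**:
`∇^kRm = treindex (curvIdxEquiv k) (tcovIter (G t) b k (rm4 (G t) b))` (induction on `k`;
`tcov_treindex` and the agreement of the successor conventions). Hence the coordinate-derivative
conversion `IsMetricOn.fderiv_tcovIter_apply` of `CoordRicciCovariantIter.lean` applies to `∇^kRm`
without a second representation. [folklore] -/
theorem curvD_eq_tcovIter (k : ℕ) (t : ℝ) :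
    curvD G b k t = treindex (curvIdxEquiv k) (tcovIter (G t) b k (rm4 (G t) b)) := by
  induction k with
  | zero =>
    funext x J
    rw [curvD_zero, treindex_apply, tcovIter_zero_apply]
    congr 1
    funext j
    simp only [Function.comp_apply]
    congr 1
    exact Fin.ext (by rw [val_curvIdxEquiv_inr, Nat.zero_add])
  | succ k ih =>
    rw [curvD_succ, ih, tcov_treindex, treindex_treindex, curvIdxEquiv_optionCongr_trans_idxEquiv,
      ← treindex_treindex]
    rfl

/-- `∂_t ∇^kRm = Δ ∇^kRm + curvL k` (definition of `curvL`). [cite: Topping2006, §3.3, (3.3.3)] -/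
theorem tder_curvD (k : ℕ) (t : ℝ) (x : E) (I : Fin (4 + k) → ι) :
    tder (curvD G b k) S t x I = tlap (G t) b (curvD G b k t) x I + curvL G S b k t x I := by
  rw [curvL]; ring

variable {V : Set E} {t : ℝ} [CompleteSpace E]

/-- **`∇^k Rm` is a smooth family on `V × S`.** [cite: Topping2006, §1.2.3] -/
theorem IsMetricFamilyOn.tsmoothFamOn_curvD (hG : IsMetricFamilyOn G S V) (k : ℕ) :
    TSmoothFamOn (curvD G b k) V S := by
  induction k with
  | zero => exact hG.tsmoothFamOn_rm4 b
  | succ k ih => exact (hG.tsmoothFamOn_tcov b ih).treindex _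

/-- `curvL k` is a smooth family on `V × S`. [cite: Topping2006, §1.2.3] -/
theorem IsMetricFamilyOn.tsmoothFamOn_curvL (hG : IsMetricFamilyOn G S V) (ht₀ : t ∈ S) (k : ℕ) :
    TSmoothFamOn (curvL G S b k) V S :=
  ((hG.tsmoothFamOn_curvD b k).tder (hG.isOpen ht₀) hG.uniqueDiffOn).sub
    (hG.tsmoothFamOn_tlap b (hG.tsmoothFamOn_curvD b k))

end CurvD

/-! ### The `*`-calculus: fields generated by `∇^pRm ⊗ ∇^qRm` -/

section Star

variable [Fintype ι] (G : ℝ → E → E →L[ℝ] E →L[ℝ] ℝ) (S : Set ℝ) (V : Set E) (b : Basis ι ℝ E)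
  [FiniteDimensional ℝ E]

/-- **Hamilton's `Rm * Rm`-calculus made precise.** `StarQuad G S V b n γ F` says that the
time-dependent component field `F` of index type `γ` is built from the tensor products
`∇^pRm ⊗ ∇^qRm` with `p + q = n` by relabelling of slots, metric traces, sums and scalar
multiples, up to agreement on `V × S` (Topping 2006, §2.2: "`A * B` denotes any linear combination
of contractions of `A ⊗ B` with the metric"; Hamilton 1982, §13). [cite: Topping2006, §2.2] -/
inductive StarQuad : ℕ → ∀ (γ : Type) [Fintype γ] [DecidableEq γ], (ℝ → E → (γ → ι) → ℝ) → Prop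
  | prod (p q : ℕ) :
      StarQuad (p + q) (Fin (4 + p) ⊕ Fin (4 + q)) (fun t ↦ tprod (curvD G b p t) (curvD G b q t))
  | reindex {n : ℕ} {γ γ' : Type} [Fintype γ] [DecidableEq γ] [Fintype γ'] [DecidableEq γ']
      (e : γ ≃ γ') {F : ℝ → E → (γ → ι) → ℝ} :
      StarQuad n γ F → StarQuad n γ' (fun t ↦ treindex e (F t))
  | tr {n : ℕ} {γ : Type} [Fintype γ] [DecidableEq γ] {F : ℝ → E → (Option (Option γ) → ι) → ℝ} :
      StarQuad n (Option (Option γ)) F → StarQuad n γ (fun t ↦ ttr (G t) b (F t))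
  | add {n : ℕ} {γ : Type} [Fintype γ] [DecidableEq γ] {F F' : ℝ → E → (γ → ι) → ℝ} :
      StarQuad n γ F → StarQuad n γ F' → StarQuad n γ (fun t ↦ F t + F' t)
  | smul {n : ℕ} {γ : Type} [Fintype γ] [DecidableEq γ] (c : ℝ) {F : ℝ → E → (γ → ι) → ℝ} :
      StarQuad n γ F → StarQuad n γ (fun t ↦ c • F t)
  | eqOn {n : ℕ} {γ : Type} [Fintype γ] [DecidableEq γ] {F F' : ℝ → E → (γ → ι) → ℝ} :
      StarQuad n γ F → (∀ t ∈ S, ∀ x ∈ V, ∀ I, F' t x I = F t x I) → StarQuad n γ F'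

variable {G S V b} {n : ℕ} {γ : Type} [Fintype γ] [DecidableEq γ] {F F' : ℝ → E → (γ → ι) → ℝ}

/-- Transport of the level along an equality of naturals. [folklore] -/
theorem StarQuad.cast {m : ℕ} (h : StarQuad G S V b n γ F) (hnm : n = m) : StarQuad G S V b m γ F := by
  subst hnm; exact h

/-- Negatives. [folklore] -/
theorem StarQuad.neg (h : StarQuad G S V b n γ F) : StarQuad G S V b n γ (fun t ↦ -F t) := by
  have h' := h.smul (-1)
  refine h'.eqOn fun t _ x _ I ↦ ?_
  simp

/-- Differences. [folklore] -/
theorem StarQuad.sub (h : StarQuad G S V b n γ F) (h' : StarQuad G S V b n γ F') :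
    StarQuad G S V b n γ (fun t ↦ F t - F' t) := by
  refine (h.add h'.neg).eqOn fun t _ x _ I ↦ ?_
  simp [sub_eq_add_neg]

/-- The zero field (at any level). [folklore] -/
theorem StarQuad.zero (n : ℕ) (γ : Type) [Fintype γ] [DecidableEq γ]
    (h : ∃ F : ℝ → E → (γ → ι) → ℝ, StarQuad G S V b n γ F) : StarQuad G S V b n γ (fun _ ↦ 0) := by
  obtain ⟨F, hF⟩ := h
  refine (hF.smul 0).eqOn fun t _ x _ I ↦ ?_
  simp

/-- Finite sums. [folklore] -/
theorem StarQuad.sum {κ : Type*} (s : Finset κ) {Fc : κ → ℝ → E → (γ → ι) → ℝ}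
    (h : ∀ c ∈ s, StarQuad G S V b n γ (Fc c)) (hne : s.Nonempty) :
    StarQuad G S V b n γ (fun t ↦ ∑ c ∈ s, Fc c t) := by
  classical
  induction s using Finset.induction_on with
  | empty => exact absurd hne (by simp)
  | insert c s hc ih =>
    by_cases hs : s.Nonempty
    · have h1 := (h c (Finset.mem_insert_self c s)).add (ih (fun c' hc' ↦ h c' (Finset.mem_insert_of_mem hc')) hs)
      refine h1.eqOn fun t _ x _ I ↦ ?_
      rw [Finset.sum_insert hc]
    · rw [Finset.not_nonempty_iff_eq_empty] at hs
      subst hs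
      refine (h c (Finset.mem_insert_self c _)).eqOn fun t _ x _ I ↦ ?_
      simp

variable [CompleteSpace E] {t : ℝ}

/-- **Every `*`-field is a smooth family on `V × S`.** [cite: Topping2006, §1.2.3] -/
theorem StarQuad.tsmoothFamOn (hG : IsMetricFamilyOn G S V) (h : StarQuad G S V b n γ F) :
    TSmoothFamOn F V S := by
  induction h with
  | prod p q => exact (hG.tsmoothFamOn_curvD b p).tprod (hG.tsmoothFamOn_curvD b q)
  | reindex e _ ih => exact ih.treindex e
  | tr _ ih => exact hG.tsmoothFamOn_ttr b ih
  | add _ _ ih ih' => exact ih.add ih'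
  | smul c _ ih => exact ih.smul c
  | eqOn _ hEq ih => exact ih.congr hEq

/-- **Closure of the `*`-calculus under `∇`** (level `n ↦ n + 1`): by the Leibniz rule
(`tcov_tprod_eq`), `∇ ∘ relabel = relabel ∘ ∇` (`tcov_treindex`), `∇ ∘ tr = tr ∘ relabel ∘ ∇`
(`tcov_ttr_eq`, i.e. `∇g⁻¹ = 0`) and linearity. [cite: Topping2006, §2.2] -/
theorem StarQuad.deriv (hG : IsMetricFamilyOn G S V) (ht₀ : t ∈ S) (h : StarQuad G S V b n γ F) :
    StarQuad G S V b (n + 1) (Option γ) (fun s ↦ tcov (G s) b (F s)) := by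
  induction h with
  | prod p q =>
    have hV := hG.isOpen ht₀
    -- Leibniz
    have h1 : StarQuad G S V b (p + 1 + q) (Option (Fin (4 + p)) ⊕ Fin (4 + q))
        (fun s ↦ tprod (tcov (G s) b (curvD G b p s)) (curvD G b q s)) := by
      have h0 := (StarQuad.prod (G := G) (S := S) (V := V) (b := b) (p + 1) q).reindex
        ((idxEquiv p).symm.sumCongr (Equiv.refl (Fin (4 + q))))
      refine h0.eqOn fun s _ y _ K ↦ ?_
      rw [tcov_curvD, tprod_treindex_left]
    have h2 : StarQuad G S V b (p + (q + 1)) (Fin (4 + p) ⊕ Option (Fin (4 + q)))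
        (fun s ↦ tprod (curvD G b p s) (tcov (G s) b (curvD G b q s))) := by
      have h0 := (StarQuad.prod (G := G) (S := S) (V := V) (b := b) p (q + 1)).reindex
        ((Equiv.refl (Fin (4 + p))).sumCongr (idxEquiv q).symm)
      refine h0.eqOn fun s _ y _ K ↦ ?_
      rw [tcov_curvD, tprod_treindex_right]
    have h3 := ((h1.cast (m := p + q + 1) (by ring)).reindex (sumOptionLeft (Fin (4 + p)) (Fin (4 + q)))).add
      ((h2.cast (m := p + q + 1) (by ring)).reindex (sumOptionRight (Fin (4 + p)) (Fin (4 + q))))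
    refine h3.eqOn fun s hs y hy K ↦ ?_
    exact tcov_tprod_eq hV ((hG.tsmoothFamOn_curvD b p).slice hs) ((hG.tsmoothFamOn_curvD b q).slice hs)
      hy K
  | reindex e hF ih =>
    refine (ih.reindex e.optionCongr).eqOn fun s _ y _ K ↦ ?_
    rw [tcov_treindex]
  | tr hF ih =>
    refine ((ih.reindex (cycTop _)).tr).eqOn fun s hs y hy J ↦ ?_
    exact (hG.isMetricOn s hs).tcov_ttr_eq ((hF.tsmoothFamOn hG).slice hs) hy J
  | add hF hF' ih ih' =>
    refine (ih.add ih').eqOn fun s hs y hy J ↦ ?_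
    exact tcov_add_apply (hG.isOpen hs) ((hF.tsmoothFamOn hG).slice hs) ((hF'.tsmoothFamOn hG).slice hs) hy J
  | smul c hF ih =>
    refine (ih.smul c).eqOn fun s hs y hy J ↦ ?_
    rw [Pi.smul_apply, Pi.smul_apply]
    exact tcov_smul_apply (hG.isOpen hs) ((hF.tsmoothFamOn hG).slice hs) c hy J
  | eqOn hF hEq ih =>
    refine ih.eqOn fun s hs y hy J ↦ ?_
    exact tcov_congr (hG.isOpen hs) (fun z hz I ↦ hEq s hs z hz I) hy J

omit [CompleteSpace E] in
/-- **Pointwise bound of `*`-fields**: at points where `G t x` is positive definite, a field of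
level `n` is bounded by `C Σ_{p ≤ n} |∇^pRm| |∇^{n−p}Rm|` (`|S ⊗ T| = |S||T|`, relabelling is
isometric, `|tr T| ≤ √n |T|`, triangle inequality). [cite: Topping2006, §3.3, (3.3.4)] -/
theorem StarQuad.norm_le (h : StarQuad G S V b n γ F) :
    ∃ C : ℝ, 0 ≤ C ∧ ∀ t ∈ S, ∀ x ∈ V, (∀ v w, G t x v w = G t x w v) → (∀ v, v ≠ 0 → 0 < G t x v v) →
      Real.sqrt (tnormSq (G t) b (F t) x) ≤
        C * ∑ p ∈ Finset.range (n + 1), Real.sqrt (tnormSq (G t) b (curvD G b p t) x) *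
          Real.sqrt (tnormSq (G t) b (curvD G b (n - p) t) x) := by
  induction h with
  | prod p q =>
    refine ⟨1, zero_le_one, fun t ht x hx hs hpos ↦ ?_⟩
    rw [one_mul, tnormSq_tprod, Real.sqrt_mul (tnormSq_nonneg b hs hpos _)]
    have hmem : p ∈ Finset.range (p + q + 1) := Finset.mem_range.mpr (by omega)
    have hpq : p + q - p = q := by omega
    refine le_trans (le_of_eq (by rw [hpq])) (Finset.single_le_sum (f := fun p' ↦
      Real.sqrt (tnormSq (G t) b (curvD G b p' t) x) * Real.sqrt (tnormSq (G t) b (curvD G b (p + q - p') t) x))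
      (fun p' _ ↦ mul_nonneg (Real.sqrt_nonneg _) (Real.sqrt_nonneg _)) hmem)
  | reindex e _ ih =>
    obtain ⟨C, hC, hb⟩ := ih
    exact ⟨C, hC, fun t ht x hx hs hpos ↦ by rw [tnormSq_treindex]; exact hb t ht x hx hs hpos⟩
  | @tr n γ _ _ F _ ih =>
    obtain ⟨C, hC, hb⟩ := ih
    refine ⟨Real.sqrt (Fintype.card ι) * C, mul_nonneg (Real.sqrt_nonneg _) hC, fun t ht x hx hs hpos ↦ ?_⟩
    have h1 := Real.sqrt_le_sqrt (tnormSq_ttr_le b hs hpos (F t))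
    rw [Real.sqrt_mul (Nat.cast_nonneg _)] at h1
    refine h1.trans ?_
    rw [mul_assoc]
    exact mul_le_mul_of_nonneg_left (hb t ht x hx hs hpos) (Real.sqrt_nonneg _)
  | add _ _ ih ih' =>
    obtain ⟨C, hC, hb⟩ := ih
    obtain ⟨C', hC', hb'⟩ := ih'
    refine ⟨C + C', add_nonneg hC hC', fun t ht x hx hs hpos ↦ ?_⟩
    refine (sqrt_tnormSq_add_le b hs hpos _ _).trans ?_
    rw [add_mul]
    exact add_le_add (hb t ht x hx hs hpos) (hb' t ht x hx hs hpos)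
  | smul c _ ih =>
    obtain ⟨C, hC, hb⟩ := ih
    refine ⟨|c| * C, mul_nonneg (abs_nonneg c) hC, fun t ht x hx hs hpos ↦ ?_⟩
    rw [tnormSq_smul, Real.sqrt_mul (sq_nonneg c), Real.sqrt_sq_eq_abs, mul_assoc]
    exact mul_le_mul_of_nonneg_left (hb t ht x hx hs hpos) (abs_nonneg c)
  | @eqOn n γ _ _ F F' _ hEq ih =>
    obtain ⟨C, hC, hb⟩ := ih
    refine ⟨C, hC, fun t ht x hx hs hpos ↦ ?_⟩
    have : tnormSq (G t) b (F' t) x = tnormSq (G t) b (F t) x := by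
      simp only [tnormSq_eq, tinner_apply, hEq t ht x hx]
    rw [this]
    exact hb t ht x hx hs hpos

end Star

end MetricCoord

end Literature.Geometry.Lorentzian

end
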